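import Mathlib

/-!
# Parity lemmas for `proofs/T1_lead.md` Prop. 5.1 (blind cell pub-manin-gamma0, seat p2)

Machine-checked versions of the load-bearing mod-8 bookkeeping steps («F1» in `review/T1_lead_redteam_p2.md`):

* `ManinGammaPub0.P2.prop51_option2_parity` : if `p ≡ 3 (mod 4)`, `a² + p b² = 2 m²` and not both `a, b` are even,
  then `a, b` are odd, `p ≡ 7 (mod 8)` and `m` is even  (T1_lead Prop 5.1, OPTION 2, final step).
* `ManinGammaPub0.P2.option3_subcase_kP_one` : two odd squares never sum to a square (OPTION 3, sub-case `k_P = 1`).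
* `ManinGammaPub0.P2.option3_subcase_kP_two` : `x² − p y² = r²` with `x, y, p` odd forces `p ≡ 1 (mod 4)`
  (OPTION 3, sub-case `k_P = (2,2p,p)`, contradicting `p ≡ 3 (mod 4)`).

All proofs: reduce to `ZMod 8` and decide the finitely many cases (no `native_decide`, standard axioms only).
-/

namespace ManinGammaPub0.P2

/-- Parity of an integer is read off from the residue of its image in `ZMod 8`. -/
lemma two_dvd_iff_val_mod_two (a : ℤ) : 2 ∣ a ↔ ((a : ZMod 8)).val % 2 = 0 := by
  have h : (((a : ZMod 8)).val : ℤ) = a % 8 := ZMod.val_intCast a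
  omega

/-- An integer with `p % 8 = r` maps to the numeral `r` in `ZMod 8` (used for `r = 3, 7`). -/
lemma cast_eq_of_emod_eq (p r : ℤ) (hr : p % 8 = r) : (p : ZMod 8) = (r : ZMod 8) := by
  rw [← ZMod.intCast_mod p 8]
  exact_mod_cast congrArg (Int.cast : ℤ → ZMod 8) hr

/-- Finite core of OPTION 2 with `p ≡ 3 (mod 8)`: no admissible solution at all. -/
theorem prop51_option2_core3 :
    ∀ a b m : ZMod 8, a ^ 2 + 3 * b ^ 2 = 2 * m ^ 2 → ¬ (a.val % 2 = 0 ∧ b.val % 2 = 0) → False := by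
  decide

/-- Finite core of OPTION 2 with `p ≡ 7 (mod 8)`: `a, b` odd and `m` even. -/
theorem prop51_option2_core7 :
    ∀ a b m : ZMod 8, a ^ 2 + 7 * b ^ 2 = 2 * m ^ 2 → ¬ (a.val % 2 = 0 ∧ b.val % 2 = 0) →
      (a.val % 2 ≠ 0 ∧ b.val % 2 ≠ 0 ∧ m.val % 2 = 0) := by
  decide

/-- T1_lead Prop 5.1, OPTION 2, last step: `a² + p b² = 2 m²`, `p ≡ 3 (mod 4)`, not both `a, b` even
⟹ `a, b` odd, `p ≡ 7 (mod 8)` and `m` even. -/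
theorem prop51_option2_parity (a b m p : ℤ) (hp : p % 4 = 3)
    (h : a ^ 2 + p * b ^ 2 = 2 * m ^ 2) (hab : ¬ (2 ∣ a ∧ 2 ∣ b)) :
    ¬ 2 ∣ a ∧ ¬ 2 ∣ b ∧ p % 8 = 7 ∧ 2 ∣ m := by
  have h8 : ((a : ZMod 8)) ^ 2 + (p : ZMod 8) * (b : ZMod 8) ^ 2 = 2 * (m : ZMod 8) ^ 2 := by
    have := congrArg (Int.cast : ℤ → ZMod 8) h
    push_cast at this
    exact this
  have hab' : ¬ (((a : ZMod 8)).val % 2 = 0 ∧ ((b : ZMod 8)).val % 2 = 0) := by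
    rw [← two_dvd_iff_val_mod_two, ← two_dvd_iff_val_mod_two]; exact hab
  have hp8 : p % 8 = 3 ∨ p % 8 = 7 := by omega
  rcases hp8 with hp8 | hp8
  · exfalso
    have hp3 : (p : ZMod 8) = 3 := by exact_mod_cast cast_eq_of_emod_eq p 3 hp8
    rw [hp3] at h8
    exact prop51_option2_core3 _ _ _ h8 hab'
  · have hp7 : (p : ZMod 8) = 7 := by exact_mod_cast cast_eq_of_emod_eq p 7 hp8
    rw [hp7] at h8
    obtain ⟨ha, hb, hm⟩ := prop51_option2_core7 _ _ _ h8 hab'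
    refine ⟨?_, ?_, hp8, ?_⟩
    · rw [two_dvd_iff_val_mod_two]; exact ha
    · rw [two_dvd_iff_val_mod_two]; exact hb
    · rw [two_dvd_iff_val_mod_two]; exact hm

/-- Finite core for OPTION 3, sub-case `k_P = 1`: odd² + odd² is never a square (mod 8). -/
theorem option3_kP_one_core :
    ∀ x y w : ZMod 8, x.val % 2 ≠ 0 → y.val % 2 ≠ 0 → x ^ 2 + y ^ 2 ≠ w ^ 2 := by
  decide

/-- T1_lead Prop 5.1, OPTION 3, sub-case `k_P = 1`: with `u = x²`, `v = y²` odd squares, `u + v = w²` is impossible. -/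
theorem option3_subcase_kP_one (x y w : ℤ) (hx : ¬ 2 ∣ x) (hy : ¬ 2 ∣ y) : x ^ 2 + y ^ 2 ≠ w ^ 2 := by
  intro h
  have h8 : ((x : ZMod 8)) ^ 2 + (y : ZMod 8) ^ 2 = (w : ZMod 8) ^ 2 := by
    have := congrArg (Int.cast : ℤ → ZMod 8) h
    push_cast at this
    exact this
  rw [two_dvd_iff_val_mod_two] at hx hy
  exact option3_kP_one_core _ _ _ hx hy h8

/-- Finite core for OPTION 3, sub-case `k_P = (2,2p,p)`, residue `p ≡ 3 (mod 8)`: no solution with `x, y` odd. -/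
theorem option3_kP_two_core3 :
    ∀ x y r : ZMod 8, x.val % 2 ≠ 0 → y.val % 2 ≠ 0 → x ^ 2 - 3 * y ^ 2 ≠ r ^ 2 := by
  decide

/-- Finite core for OPTION 3, sub-case `k_P = (2,2p,p)`, residue `p ≡ 7 (mod 8)`: no solution with `x, y` odd. -/
theorem option3_kP_two_core7 :
    ∀ x y r : ZMod 8, x.val % 2 ≠ 0 → y.val % 2 ≠ 0 → x ^ 2 - 7 * y ^ 2 ≠ r ^ 2 := by
  decide

/-- T1_lead Prop 5.1, OPTION 3, sub-case `k_P = (2,2p,p)`: `u = x²` (`x` odd), `v = p y²` (`y` odd), `u − v = r²`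
is impossible when `p ≡ 3 (mod 4)`. -/
theorem option3_subcase_kP_two (x y r p : ℤ) (hx : ¬ 2 ∣ x) (hy : ¬ 2 ∣ y) (hp : p % 4 = 3)
    (h : x ^ 2 - p * y ^ 2 = r ^ 2) : False := by
  have h8 : ((x : ZMod 8)) ^ 2 - (p : ZMod 8) * (y : ZMod 8) ^ 2 = (r : ZMod 8) ^ 2 := by
    have := congrArg (Int.cast : ℤ → ZMod 8) h
    push_cast at this
    exact this
  rw [two_dvd_iff_val_mod_two] at hx hy
  have hp8 : p % 8 = 3 ∨ p % 8 = 7 := by omega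
  rcases hp8 with hp8 | hp8
  · have hp3 : (p : ZMod 8) = 3 := by exact_mod_cast cast_eq_of_emod_eq p 3 hp8
    rw [hp3] at h8
    exact option3_kP_two_core3 _ _ _ hx hy h8
  · have hp7 : (p : ZMod 8) = 7 := by exact_mod_cast cast_eq_of_emod_eq p 7 hp8
    rw [hp7] at h8
    exact option3_kP_two_core7 _ _ _ hx hy h8

end ManinGammaPub0.P2
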